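import Literature.MathematicalPhysics.QuantumManyBody.LHYDispersionReplacement
import HarnessLib

/-!
# Replacing `τ(p)` by `p²` and `ĝ(p)` by `ĝ(0)`: the low-momentum sum and the full estimate (FGJMOT Lemma 8.1, first part)

Topic `Literature/MathematicalPhysics/QuantumManyBody`, namespace `BoseGas` (provefact
`Literature.MathematicalPhysics.QuantumManyBody.BoseGas.Junge2026_neumannBox_pinnedLowerBound`; brick 18c,
companion of `LHYDispersionReplacement.lean`). In lattice units — Neumann momenta `p = h|k|`,
`k ∈ ℕ₀³`, `h = π/ℓ`, `|k| = ‖k‖₂` — and with the Fourier transform abstracted to a function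
`ĝ : ℕ₀³ → ℝ` with `|ĝ(k) - ĝ₀| ≤ R²ĝ₀(h|k|)²`, `|ĝ(k)| ≤ ĝ₀` (`ĝ₀ = ĝ(0) = 8πa`, cf.
`FourierBoundCompactSupport.lean`), we sum the termwise estimate `abs_tauG_sub_sqG_le` over the
low momenta `0 < |k|∞ < N` and add the tail `sum_high_tail_le`:

* `card_filter_sup_pos_lt`, `sum_inv_sup_sq_le`, `sum_inv_sup_pow_four_le_24` — lattice counting:
  `#{0 < |k|∞ < N} ≤ N³`, `Σ_{0<|k|∞<N}|k|∞⁻² ≤ 12N`, `Σ_{|k|∞ ≥ 1}|k|∞⁻⁴ ≤ 24`;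
* `sum_low_replacement_le` — `Σ_{0<|k|∞<N}|τG(y/τ) - p²G(y₀/p²)| ≤ 4YεN³ + 6Y²Σ_{0<|k|∞<N}δ_k/p_k⁴`;
* `FournaisEtAl2024_lemma81_replacement` — with the dispersion `τ` of the paper,
  `τ = p² - h²/(2π)` on the low modes and `τ = p² - h²/(2π) - K_Hh²/π²` on the high modes `π|k| > K_H`
  (`K_H ≥ 4`), `y = ρ_zĝ`, `Y = ρ_zĝ₀`, `ε = ρ_zR²ĝ₀`: over every finite set of non-zero modes,
  `Σ|τG(y/τ) - p²G(Y/p²)| ≤ 204Y³/(h⁴N) + 4YεN³ + 6Y²(12/(πh²)·2 + 12N/(K_Hh²))`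
  provided `Y ≤ (3/16)(hN)²` and `3R²h²N² ≤ 1` — the first three displays of the proof of
  Lemma 8.1 with explicit constants (the paper: `≤ CK_ℓ^{1/4}(ρa)(ℓ⁻²R²K⁵ + ρaR²K_ℓ^{1/4}K³ + K + K_ℓ^{9/4})`
  after their choice of parameters).

No definitions.

## References

* [FournaisEtAl2024] S. Fournais et al., arXiv:2408.14222, Ann. Henri Poincaré (2026): Lemma 8.1
  (proof, first three displays), (2.10), (2.27) (the symbol `τ`).
-/

noncomputable section

open Finset
open scoped BigOperators

namespace Literature.MathematicalPhysics.QuantumManyBody.BoseGas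

/-! ### Lattice counting -/

/-- `#{k : 0 < |k|∞ < N} ≤ N³`. [folklore] -/
theorem card_filter_sup_pos_lt (N : ℕ) (u : Finset (Fin 3 → ℕ)) :
    ((u.filter fun k => 0 < univ.sup k ∧ univ.sup k < N).card : ℝ) ≤ (N : ℝ) ^ 3 := by
  have hsub : (u.filter fun k => 0 < univ.sup k ∧ univ.sup k < N) ⊆ Fintype.piFinset (fun _ : Fin 3 => range N) :=
    fun k hk => mem_piFinset_range_of_sup_lt (mem_filter.1 hk).2.2
  have h := card_le_card hsub
  rw [card_piFinset_range] at h
  exact_mod_cast h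

/-- **`Σ_{k ∈ u, 0 < |k|∞ < N} |k|∞⁻² ≤ 12N`** (shells: `≤ Σ_{j<N} 3(j+1)²/j² ≤ 12N`). [folklore] -/
theorem sum_inv_sup_sq_le (N : ℕ) (u : Finset (Fin 3 → ℕ)) :
    ∑ k ∈ u.filter (fun k => 0 < univ.sup k ∧ univ.sup k < N), (((univ.sup k : ℕ) : ℝ) ^ 2)⁻¹ ≤ 12 * N := by
  set T := u.filter (fun k => 0 < univ.sup k ∧ univ.sup k < N) with hT
  have hmaps : ∀ k ∈ T, univ.sup k ∈ Finset.Ico 1 N := fun k hk => by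
    have h := (mem_filter.1 hk).2
    exact Finset.mem_Ico.2 ⟨h.1, h.2⟩
  rw [← sum_fiberwise_of_maps_to hmaps]
  have hinner : ∀ j ∈ Finset.Ico 1 N,
      ∑ k ∈ T.filter (fun k => univ.sup k = j), (((univ.sup k : ℕ) : ℝ) ^ 2)⁻¹ ≤ 12 := by
    intro j hj
    have hj1 : (1 : ℝ) ≤ j := by exact_mod_cast (Finset.mem_Ico.1 hj).1
    have hj0 : (0 : ℝ) < j := by linarith
    calc ∑ k ∈ T.filter (fun k => univ.sup k = j), (((univ.sup k : ℕ) : ℝ) ^ 2)⁻¹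
        = ∑ k ∈ T.filter (fun k => univ.sup k = j), (((j : ℕ) : ℝ) ^ 2)⁻¹ :=
          sum_congr rfl fun k hk => by rw [(mem_filter.1 hk).2]
      _ = ((T.filter fun k => univ.sup k = j).card : ℝ) * ((j : ℝ) ^ 2)⁻¹ := by rw [sum_const, nsmul_eq_mul]
      _ ≤ 3 * ((j : ℝ) + 1) ^ 2 * ((j : ℝ) ^ 2)⁻¹ := by gcongr; exact card_filter_sup_eq_le j T
      _ ≤ 12 * (j : ℝ) ^ 2 * ((j : ℝ) ^ 2)⁻¹ := by
          apply mul_le_mul_of_nonneg_right _ (by positivity); nlinarith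
      _ = 12 := by field_simp
  calc ∑ j ∈ Finset.Ico 1 N, ∑ k ∈ T.filter (fun k => univ.sup k = j), (((univ.sup k : ℕ) : ℝ) ^ 2)⁻¹
      ≤ ∑ _j ∈ Finset.Ico 1 N, (12 : ℝ) := sum_le_sum hinner
    _ = 12 * ((N - 1 : ℕ) : ℝ) := by rw [sum_const, Nat.card_Ico, nsmul_eq_mul, mul_comm]
    _ ≤ 12 * N := by gcongr; exact_mod_cast Nat.sub_le N 1

/-- `Σ_{k ∈ u, |k|∞ ≥ 1} |k|∞⁻⁴ ≤ 24`. [folklore] -/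
theorem sum_inv_sup_pow_four_le_24 (u : Finset (Fin 3 → ℕ)) :
    ∑ k ∈ u.filter (fun k => 1 ≤ univ.sup k), (((univ.sup k : ℕ) : ℝ) ^ 4)⁻¹ ≤ 24 := by
  have h := sum_inv_sup_pow_four_le (le_refl 1) u
  simpa using h

/-! ### The low-momentum sum -/

/-- **The low-momentum sum of Lemma 8.1** (termwise estimate summed): with `p_k² = (h|k|)²`,
`τ_k ≥ p_k²/2`, `|τ_k - p_k²| ≤ δ_k`, `0 ≤ y_k, y₀ ≤ Y`, `|y_k - y₀| ≤ εp_k²` on the modes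
`0 < |k|∞ < N`, `Σ_{0<|k|∞<N}|τG(y/τ) - p²G(y₀/p²)| ≤ 4YεN³ + 6Y²Σ_{0<|k|∞<N}δ_k/p_k⁴`.
[cite: FournaisEtAl2024, Lemma 8.1 (proof, third display)] -/
theorem sum_low_replacement_le {h Y y₀ ε : ℝ} (hh : 0 < h) (hY : 0 ≤ Y) (hε : 0 ≤ ε) (hy₀ : 0 ≤ y₀) (hy₀Y : y₀ ≤ Y)
    (τ y δ : (Fin 3 → ℕ) → ℝ) {N : ℕ}
    (hτ : ∀ k : Fin 3 → ℕ, 0 < univ.sup k → (h * ‖(WithLp.toLp 2 (fun i => (k i : ℝ)) : Space)‖) ^ 2 / 2 ≤ τ k)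
    (hδ : ∀ k : Fin 3 → ℕ, 0 < univ.sup k → |τ k - (h * ‖(WithLp.toLp 2 (fun i => (k i : ℝ)) : Space)‖) ^ 2| ≤ δ k)
    (hy0 : ∀ k : Fin 3 → ℕ, 0 < univ.sup k → univ.sup k < N → 0 ≤ y k)
    (hyY : ∀ k, y k ≤ Y)
    (hyε : ∀ k : Fin 3 → ℕ, |y k - y₀| ≤ ε * (h * ‖(WithLp.toLp 2 (fun i => (k i : ℝ)) : Space)‖) ^ 2)
    (u : Finset (Fin 3 → ℕ)) :
    ∑ k ∈ u.filter (fun k => 0 < univ.sup k ∧ univ.sup k < N),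
        |τ k * (Real.sqrt (1 + 2 * (y k / τ k)) - 1 - y k / τ k + (y k / τ k) ^ 2 / 2) -
          (h * ‖(WithLp.toLp 2 (fun i => (k i : ℝ)) : Space)‖) ^ 2 *
            (Real.sqrt (1 + 2 * (y₀ / (h * ‖(WithLp.toLp 2 (fun i => (k i : ℝ)) : Space)‖) ^ 2)) - 1 -
              y₀ / (h * ‖(WithLp.toLp 2 (fun i => (k i : ℝ)) : Space)‖) ^ 2 +
              (y₀ / (h * ‖(WithLp.toLp 2 (fun i => (k i : ℝ)) : Space)‖) ^ 2) ^ 2 / 2)| ≤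
      4 * Y * ε * (N : ℝ) ^ 3 +
        6 * Y ^ 2 * ∑ k ∈ u.filter (fun k => 0 < univ.sup k ∧ univ.sup k < N),
          δ k / ((h * ‖(WithLp.toLp 2 (fun i => (k i : ℝ)) : Space)‖) ^ 2) ^ 2 := by
  set T := u.filter (fun k => 0 < univ.sup k ∧ univ.sup k < N) with hT
  have hterm : ∀ k ∈ T,
      |τ k * (Real.sqrt (1 + 2 * (y k / τ k)) - 1 - y k / τ k + (y k / τ k) ^ 2 / 2) -
          (h * ‖(WithLp.toLp 2 (fun i => (k i : ℝ)) : Space)‖) ^ 2 *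
            (Real.sqrt (1 + 2 * (y₀ / (h * ‖(WithLp.toLp 2 (fun i => (k i : ℝ)) : Space)‖) ^ 2)) - 1 -
              y₀ / (h * ‖(WithLp.toLp 2 (fun i => (k i : ℝ)) : Space)‖) ^ 2 +
              (y₀ / (h * ‖(WithLp.toLp 2 (fun i => (k i : ℝ)) : Space)‖) ^ 2) ^ 2 / 2)| ≤
        6 * Y ^ 2 * δ k / ((h * ‖(WithLp.toLp 2 (fun i => (k i : ℝ)) : Space)‖) ^ 2) ^ 2 + 4 * Y * ε := by
    intro k hk
    obtain ⟨hk0, hkN⟩ := (mem_filter.1 hk).2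
    have hsup : (0 : ℝ) < ((univ.sup k : ℕ) : ℝ) := by exact_mod_cast hk0
    have hv : 0 < ‖(WithLp.toLp 2 (fun i => (k i : ℝ)) : Space)‖ := hsup.trans_le (sup_le_norm_toLp k)
    have hP2 : 0 < (h * ‖(WithLp.toLp 2 (fun i => (k i : ℝ)) : Space)‖) ^ 2 := by positivity
    exact abs_tauG_sub_sqG_le hP2 (hτ k hk0) (hδ k hk0) (hy0 k hk0 hkN) (hyY k) hy₀ hy₀Y (hyε k)
  calc _ ≤ ∑ k ∈ T, (6 * Y ^ 2 * δ k / ((h * ‖(WithLp.toLp 2 (fun i => (k i : ℝ)) : Space)‖) ^ 2) ^ 2 + 4 * Y * ε) :=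
        sum_le_sum hterm
    _ = 6 * Y ^ 2 * ∑ k ∈ T, δ k / ((h * ‖(WithLp.toLp 2 (fun i => (k i : ℝ)) : Space)‖) ^ 2) ^ 2 +
          (T.card : ℝ) * (4 * Y * ε) := by
        rw [sum_add_distrib, sum_const, nsmul_eq_mul, mul_sum]
        refine congrArg₂ (· + ·) (sum_congr rfl fun k _ => ?_) rfl
        ring
    _ ≤ 6 * Y ^ 2 * ∑ k ∈ T, δ k / ((h * ‖(WithLp.toLp 2 (fun i => (k i : ℝ)) : Space)‖) ^ 2) ^ 2 +
          (N : ℝ) ^ 3 * (4 * Y * ε) := by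
        gcongr
        exact card_filter_sup_pos_lt N u
    _ = _ := by ring

/-! ### The estimate of Lemma 8.1 with the dispersion `τ` of the paper -/

/-- `|k|₂² ≤ 3|k|∞²` for a lattice point. [folklore] -/
theorem norm_toLp_sq_le_three_mul_sup_sq (k : Fin 3 → ℕ) :
    ‖(WithLp.toLp 2 (fun i => (k i : ℝ)) : Space)‖ ^ 2 ≤ 3 * ((univ.sup k : ℕ) : ℝ) ^ 2 := by
  rw [EuclideanSpace.norm_eq, Real.sq_sqrt (sum_nonneg fun i _ => by positivity)]
  calc ∑ i, ‖(WithLp.toLp 2 (fun i => (k i : ℝ)) : Space) i‖ ^ 2 ≤ ∑ _i : Fin 3, ((univ.sup k : ℕ) : ℝ) ^ 2 := by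
        refine sum_le_sum fun i _ => ?_
        have hki : (k i : ℝ) ≤ ((univ.sup k : ℕ) : ℝ) := by exact_mod_cast Finset.le_sup (f := k) (mem_univ i)
        have : ‖(WithLp.toLp 2 (fun i => (k i : ℝ)) : Space) i‖ = (k i : ℝ) := by simp
        rw [this]
        exact pow_le_pow_left₀ (Nat.cast_nonneg _) hki 2
    _ = 3 * ((univ.sup k : ℕ) : ℝ) ^ 2 := by rw [sum_const, card_univ, Fintype.card_fin]; ring

/-- For a non-zero mode, `h²|k|∞² ≤ p² = (h|k|)²` and `h² ≤ p²`. [folklore] -/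
theorem sq_mul_sup_sq_le_momSq {h : ℝ} (hh : 0 < h) (k : Fin 3 → ℕ) (hk : 0 < univ.sup k) :
    h ^ 2 * ((univ.sup k : ℕ) : ℝ) ^ 2 ≤ (h * ‖(WithLp.toLp 2 (fun i => (k i : ℝ)) : Space)‖) ^ 2 ∧
      h ^ 2 ≤ (h * ‖(WithLp.toLp 2 (fun i => (k i : ℝ)) : Space)‖) ^ 2 := by
  have hs1 : (1 : ℝ) ≤ ((univ.sup k : ℕ) : ℝ) := by exact_mod_cast hk
  have h1 : h * ((univ.sup k : ℕ) : ℝ) ≤ h * ‖(WithLp.toLp 2 (fun i => (k i : ℝ)) : Space)‖ :=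
    mul_le_mul_of_nonneg_left (sup_le_norm_toLp k) hh.le
  have h2 := pow_le_pow_left₀ (by positivity) h1 2
  refine ⟨by rw [mul_pow] at h2; exact h2, ?_⟩
  calc h ^ 2 = (h * 1) ^ 2 := by ring
    _ ≤ (h * ((univ.sup k : ℕ) : ℝ)) ^ 2 := pow_le_pow_left₀ (by positivity) (by nlinarith) 2
    _ ≤ _ := h2

/-- **The dispersion `τ` of (2.27) versus `p²`.** With `τ(k) = (h|k|)² - h²/(2π)` on the non-zero
low modes and `τ(k) = (h|k|)² - h²/(2π) - K_Hh²/π²` on the high modes `K_H² < π²|k|²`, `K_H ≥ 4`: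
`τ ≥ p²/2` and `|τ - p²| ≤ h²/(2π) + K_Hh²/π²·1_{high}` for every `k ≠ 0` (the paper:
"`|τ(p) - p²| ≤ Cℓ⁻²` for `|p| ≤ Kℓ⁻¹`", "`|p⁻² - τ_p⁻¹| ≤ Cp⁻⁴ℓ⁻²(1 + K_H1_{p∈P_H})`").
[cite: FournaisEtAl2024, (2.27) and Lemma 8.1 (proof)] -/
theorem tau_ge_half_momSq_and_abs_sub_le {h KH : ℝ} (hh : 0 < h) (hKH : 4 ≤ KH) (τ : (Fin 3 → ℕ) → ℝ)
    (hτlow : ∀ k : Fin 3 → ℕ, 0 < univ.sup k →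
      ¬ KH ^ 2 < Real.pi ^ 2 * ‖(WithLp.toLp 2 (fun i => (k i : ℝ)) : Space)‖ ^ 2 →
        τ k = (h * ‖(WithLp.toLp 2 (fun i => (k i : ℝ)) : Space)‖) ^ 2 - h ^ 2 / (2 * Real.pi))
    (hτhigh : ∀ k : Fin 3 → ℕ, KH ^ 2 < Real.pi ^ 2 * ‖(WithLp.toLp 2 (fun i => (k i : ℝ)) : Space)‖ ^ 2 →
        τ k = (h * ‖(WithLp.toLp 2 (fun i => (k i : ℝ)) : Space)‖) ^ 2 - h ^ 2 / (2 * Real.pi) -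
          KH * h ^ 2 / Real.pi ^ 2)
    (k : Fin 3 → ℕ) (hk : 0 < univ.sup k) :
    (h * ‖(WithLp.toLp 2 (fun i => (k i : ℝ)) : Space)‖) ^ 2 / 2 ≤ τ k ∧
      |τ k - (h * ‖(WithLp.toLp 2 (fun i => (k i : ℝ)) : Space)‖) ^ 2| ≤
        (if KH ^ 2 < Real.pi ^ 2 * ‖(WithLp.toLp 2 (fun i => (k i : ℝ)) : Space)‖ ^ 2 then
          h ^ 2 / (2 * Real.pi) + KH * h ^ 2 / Real.pi ^ 2 else h ^ 2 / (2 * Real.pi)) := by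
  have hpi := Real.pi_pos
  have hpi2 : (2 : ℝ) ≤ Real.pi := Real.two_le_pi
  obtain ⟨_, hP1⟩ := sq_mul_sup_sq_le_momSq hh k hk
  by_cases hhigh : KH ^ 2 < Real.pi ^ 2 * ‖(WithLp.toLp 2 (fun i => (k i : ℝ)) : Space)‖ ^ 2
  · rw [hτhigh k hhigh, if_pos hhigh]
    have hP2K : h ^ 2 * KH ^ 2 / Real.pi ^ 2 ≤ (h * ‖(WithLp.toLp 2 (fun i => (k i : ℝ)) : Space)‖) ^ 2 := by
      rw [mul_pow, div_le_iff₀ (by positivity)]; nlinarith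
    have hP2K' : h ^ 2 * KH ^ 2 ≤ (h * ‖(WithLp.toLp 2 (fun i => (k i : ℝ)) : Space)‖) ^ 2 * Real.pi ^ 2 :=
      (div_le_iff₀ (by positivity)).1 hP2K
    constructor
    · -- `KH² ≥ π + 2KH` for `KH ≥ 4`, whence `h²(π + 2KH)/(2π²) ≤ p²/2`
      have hq : Real.pi + 2 * KH ≤ KH ^ 2 := by nlinarith [Real.pi_le_four]
      have h3 : h ^ 2 / (2 * Real.pi) + KH * h ^ 2 / Real.pi ^ 2 ≤
          (h * ‖(WithLp.toLp 2 (fun i => (k i : ℝ)) : Space)‖) ^ 2 / 2 := by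
        rw [div_add_div _ _ (by positivity) (by positivity), div_le_div_iff₀ (by positivity) (by norm_num)]
        have h4 : (h ^ 2 * Real.pi ^ 2 + 2 * Real.pi * (KH * h ^ 2)) * 2 =
            2 * Real.pi * (h ^ 2 * (Real.pi + 2 * KH)) := by ring
        rw [h4]
        have h5 : h ^ 2 * (Real.pi + 2 * KH) ≤ h ^ 2 * KH ^ 2 := mul_le_mul_of_nonneg_left hq (sq_nonneg h)
        nlinarith [h5.trans hP2K']
      linarith
    · rw [show (h * ‖(WithLp.toLp 2 (fun i => (k i : ℝ)) : Space)‖) ^ 2 - h ^ 2 / (2 * Real.pi) -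
          KH * h ^ 2 / Real.pi ^ 2 - (h * ‖(WithLp.toLp 2 (fun i => (k i : ℝ)) : Space)‖) ^ 2 =
          -(h ^ 2 / (2 * Real.pi) + KH * h ^ 2 / Real.pi ^ 2) by ring, abs_neg,
        abs_of_nonneg (by positivity)]
  · rw [hτlow k hk hhigh, if_neg hhigh]
    constructor
    · have : h ^ 2 / (2 * Real.pi) ≤ (h * ‖(WithLp.toLp 2 (fun i => (k i : ℝ)) : Space)‖) ^ 2 / 2 := by
        rw [div_le_div_iff₀ (by positivity) (by norm_num)]; nlinarith
      linarith
    · rw [show (h * ‖(WithLp.toLp 2 (fun i => (k i : ℝ)) : Space)‖) ^ 2 - h ^ 2 / (2 * Real.pi) -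
          (h * ‖(WithLp.toLp 2 (fun i => (k i : ℝ)) : Space)‖) ^ 2 = -(h ^ 2 / (2 * Real.pi)) by ring,
        abs_neg, abs_of_nonneg (by positivity)]

/-- Splitting the non-zero modes at the cut `N`. [folklore] -/
theorem sum_filter_sup_pos_split {N : ℕ} (hN : 0 < N) (u : Finset (Fin 3 → ℕ)) (F : (Fin 3 → ℕ) → ℝ) :
    ∑ k ∈ u.filter (fun k => 0 < univ.sup k), F k =
      (∑ k ∈ u.filter (fun k => 0 < univ.sup k ∧ univ.sup k < N), F k) +
        ∑ k ∈ u.filter (fun k => N ≤ univ.sup k), F k := by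
  rw [← sum_filter_add_sum_filter_not (u.filter fun k => 0 < univ.sup k) (fun k => univ.sup k < N),
    filter_filter, filter_filter]
  congr 1
  refine sum_congr (filter_congr fun k _ => ?_) fun _ _ => rfl
  constructor
  · rintro ⟨_, h2⟩; exact not_lt.1 h2
  · intro h2; exact ⟨lt_of_lt_of_le hN h2, not_lt.2 h2⟩

/-- **FGJMOT Lemma 8.1, first part (replacement of `τ(p)` by `p²` and of `ĝ(p)` by `ĝ(0)`), in
lattice units with explicit constants.** Let `h > 0` (`= π/ℓ`), `K_H ≥ 4`, `ĝ₀ > 0`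
(`= ĝ(0) = 8πa`), `ρ_z ≥ 0`, and `ĝ : ℕ₀³ → ℝ` with `|ĝ(k) - ĝ₀| ≤ R²ĝ₀(h|k|)²`, `|ĝ(k)| ≤ ĝ₀`;
let `τ` be the symbol (2.27): `τ(k) = (h|k|)² - h²/(2π)` on the non-zero low modes and
`τ(k) = (h|k|)² - h²/(2π) - K_Hh²/π²` on the high modes `K_H² < π²|k|²`. Then for every cut
`N ≥ 1` with `ρ_zĝ₀ ≤ (3/16)(hN)²` and `3R²h²N² ≤ 1` and every finite set of modes,
`Σ_{k≠0} |τ(k)G(ρ_zĝ(k)/τ(k)) - (h|k|)²G(ρ_zĝ₀/(h|k|)²)|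
  ≤ 204(ρ_zĝ₀)³/(h⁴N) + 4(ρ_zĝ₀)(ρ_zR²ĝ₀)N³ + 6(ρ_zĝ₀)²(12/(πh²) + 12N/(K_Hh²))`,
`G(t) = √(1+2t) - 1 - t + t²/2` (so `τG(ρ_zĝ/τ) = √(τ² + 2ρ_zĝτ) - τ - ρ_zĝ + (ρ_zĝ)²/(2τ)`,
`mul_lhyG_eq`). [cite: FournaisEtAl2024, Lemma 8.1 (proof, first three displays)] -/
theorem FournaisEtAl2024_lemma81_replacement {h KH R g0 ρz : ℝ} (hh : 0 < h) (hKH : 4 ≤ KH)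
    (hg0 : 0 < g0) (hρz : 0 ≤ ρz) (gh τ : (Fin 3 → ℕ) → ℝ)
    (hgh1 : ∀ k, |gh k - g0| ≤ R ^ 2 * g0 * (h * ‖(WithLp.toLp 2 (fun i => (k i : ℝ)) : Space)‖) ^ 2)
    (hgh2 : ∀ k, |gh k| ≤ g0)
    (hτlow : ∀ k : Fin 3 → ℕ, 0 < univ.sup k →
      ¬ KH ^ 2 < Real.pi ^ 2 * ‖(WithLp.toLp 2 (fun i => (k i : ℝ)) : Space)‖ ^ 2 →
        τ k = (h * ‖(WithLp.toLp 2 (fun i => (k i : ℝ)) : Space)‖) ^ 2 - h ^ 2 / (2 * Real.pi))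
    (hτhigh : ∀ k : Fin 3 → ℕ, KH ^ 2 < Real.pi ^ 2 * ‖(WithLp.toLp 2 (fun i => (k i : ℝ)) : Space)‖ ^ 2 →
        τ k = (h * ‖(WithLp.toLp 2 (fun i => (k i : ℝ)) : Space)‖) ^ 2 - h ^ 2 / (2 * Real.pi) -
          KH * h ^ 2 / Real.pi ^ 2)
    {N : ℕ} (hN : 1 ≤ N) (hsmall : ρz * g0 ≤ 3 / 16 * (h * N) ^ 2) (hRN : 3 * R ^ 2 * h ^ 2 * N ^ 2 ≤ 1)
    (u : Finset (Fin 3 → ℕ)) :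
    ∑ k ∈ u.filter (fun k => 0 < univ.sup k),
        |τ k * (Real.sqrt (1 + 2 * (ρz * gh k / τ k)) - 1 - ρz * gh k / τ k + (ρz * gh k / τ k) ^ 2 / 2) -
          (h * ‖(WithLp.toLp 2 (fun i => (k i : ℝ)) : Space)‖) ^ 2 *
            (Real.sqrt (1 + 2 * (ρz * g0 / (h * ‖(WithLp.toLp 2 (fun i => (k i : ℝ)) : Space)‖) ^ 2)) - 1 -
              ρz * g0 / (h * ‖(WithLp.toLp 2 (fun i => (k i : ℝ)) : Space)‖) ^ 2 +
              (ρz * g0 / (h * ‖(WithLp.toLp 2 (fun i => (k i : ℝ)) : Space)‖) ^ 2) ^ 2 / 2)| ≤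
      204 * (ρz * g0) ^ 3 / (h ^ 4 * N) + 4 * (ρz * g0) * (ρz * R ^ 2 * g0) * (N : ℝ) ^ 3 +
        6 * (ρz * g0) ^ 2 * (12 / (Real.pi * h ^ 2) + 12 * N / (KH * h ^ 2)) := by
  have hpi := Real.pi_pos
  have hN0 : 0 < N := by omega
  have hY0 : 0 ≤ ρz * g0 := by positivity
  have hε0 : 0 ≤ ρz * R ^ 2 * g0 := by positivity
  -- `h²|k|∞² ≤ p²`, `h² ≤ p²`, `τ ≥ p²/2`, `|τ - p²| ≤ δ` for `k ≠ 0`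
  have hP := sq_mul_sup_sq_le_momSq hh
  have hτfacts := tau_ge_half_momSq_and_abs_sub_le hh hKH τ hτlow hτhigh
  -- the `y`'s: `|ρ_zĝ(k)| ≤ ρ_zĝ₀`, `|ρ_zĝ(k) - ρ_zĝ₀| ≤ ρ_zR²ĝ₀p²`, `ρ_zĝ(k) ≥ 0` on the low modes
  have hyabs : ∀ k, |ρz * gh k| ≤ ρz * g0 := fun k => by
    rw [abs_mul, abs_of_nonneg hρz]
    exact mul_le_mul_of_nonneg_left (hgh2 k) hρz
  have hyY : ∀ k, ρz * gh k ≤ ρz * g0 := fun k => (le_abs_self _).trans (hyabs k)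
  have hyε : ∀ k : Fin 3 → ℕ, |ρz * gh k - ρz * g0| ≤
      ρz * R ^ 2 * g0 * (h * ‖(WithLp.toLp 2 (fun i => (k i : ℝ)) : Space)‖) ^ 2 := by
    intro k
    rw [← mul_sub, abs_mul, abs_of_nonneg hρz]
    calc ρz * |gh k - g0| ≤ ρz * (R ^ 2 * g0 * (h * ‖(WithLp.toLp 2 (fun i => (k i : ℝ)) : Space)‖) ^ 2) :=
          mul_le_mul_of_nonneg_left (hgh1 k) hρz
      _ = _ := by ring
  have hy0 : ∀ k : Fin 3 → ℕ, 0 < univ.sup k → univ.sup k < N → 0 ≤ ρz * gh k := by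
    intro k hk hkN
    refine mul_nonneg hρz ?_
    -- `R² p² ≤ 1` on the low modes
    have hsN : ((univ.sup k : ℕ) : ℝ) ≤ N := by exact_mod_cast hkN.le
    have hP2 : (h * ‖(WithLp.toLp 2 (fun i => (k i : ℝ)) : Space)‖) ^ 2 ≤ 3 * h ^ 2 * N ^ 2 := by
      rw [mul_pow]
      calc h ^ 2 * ‖(WithLp.toLp 2 (fun i => (k i : ℝ)) : Space)‖ ^ 2 ≤ h ^ 2 * (3 * ((univ.sup k : ℕ) : ℝ) ^ 2) :=
            mul_le_mul_of_nonneg_left (norm_toLp_sq_le_three_mul_sup_sq k) (sq_nonneg h)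
        _ ≤ h ^ 2 * (3 * (N : ℝ) ^ 2) := by gcongr
        _ = 3 * h ^ 2 * N ^ 2 := by ring
    have hRP : R ^ 2 * (h * ‖(WithLp.toLp 2 (fun i => (k i : ℝ)) : Space)‖) ^ 2 ≤ 1 := by
      calc R ^ 2 * (h * ‖(WithLp.toLp 2 (fun i => (k i : ℝ)) : Space)‖) ^ 2 ≤ R ^ 2 * (3 * h ^ 2 * N ^ 2) :=
            mul_le_mul_of_nonneg_left hP2 (sq_nonneg R)
        _ = 3 * R ^ 2 * h ^ 2 * N ^ 2 := by ring
        _ ≤ 1 := hRN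
    have h1 := hgh1 k
    rw [abs_le] at h1
    nlinarith [h1.1, mul_le_mul_of_nonneg_left hRP hg0.le]
  -- the low part
  have hlow := sum_low_replacement_le hh hY0 hε0 hY0 le_rfl τ (fun k => ρz * gh k)
    (fun k => if KH ^ 2 < Real.pi ^ 2 * ‖(WithLp.toLp 2 (fun i => (k i : ℝ)) : Space)‖ ^ 2 then
      h ^ 2 / (2 * Real.pi) + KH * h ^ 2 / Real.pi ^ 2 else h ^ 2 / (2 * Real.pi)) (N := N)
    (fun k hk => (hτfacts k hk).1) (fun k hk => (hτfacts k hk).2) hy0 hyY hyε u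
  have hδsum : ∑ k ∈ u.filter (fun k => 0 < univ.sup k ∧ univ.sup k < N),
      (if KH ^ 2 < Real.pi ^ 2 * ‖(WithLp.toLp 2 (fun i => (k i : ℝ)) : Space)‖ ^ 2 then
          h ^ 2 / (2 * Real.pi) + KH * h ^ 2 / Real.pi ^ 2 else h ^ 2 / (2 * Real.pi)) /
        ((h * ‖(WithLp.toLp 2 (fun i => (k i : ℝ)) : Space)‖) ^ 2) ^ 2 ≤
        12 / (Real.pi * h ^ 2) + 12 * N / (KH * h ^ 2) := by
    have hterm : ∀ k ∈ u.filter (fun k => 0 < univ.sup k ∧ univ.sup k < N),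
        (if KH ^ 2 < Real.pi ^ 2 * ‖(WithLp.toLp 2 (fun i => (k i : ℝ)) : Space)‖ ^ 2 then
            h ^ 2 / (2 * Real.pi) + KH * h ^ 2 / Real.pi ^ 2 else h ^ 2 / (2 * Real.pi)) /
          ((h * ‖(WithLp.toLp 2 (fun i => (k i : ℝ)) : Space)‖) ^ 2) ^ 2 ≤
          1 / (2 * Real.pi * h ^ 2) * (((univ.sup k : ℕ) : ℝ) ^ 4)⁻¹ +
            1 / (KH * h ^ 2) * (((univ.sup k : ℕ) : ℝ) ^ 2)⁻¹ := by
      intro k hk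
      obtain ⟨hk0, _⟩ := (mem_filter.1 hk).2
      obtain ⟨hPs, hP1⟩ := hP k hk0
      set P2 := (h * ‖(WithLp.toLp 2 (fun i => (k i : ℝ)) : Space)‖) ^ 2 with hP2
      set m : ℝ := ((univ.sup k : ℕ) : ℝ) with hm
      have hm1 : 1 ≤ m := by rw [hm]; exact_mod_cast hk0
      have hP2pos : 0 < P2 := lt_of_lt_of_le (by positivity) hP1
      have hm4 : 0 < m ^ 4 := by positivity
      have hm2 : 0 < m ^ 2 := by positivity
      -- `h²/(2π)/P2² ≤ 1/(2πh²m⁴)` since `P2 ≥ h²m²`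
      have hm0 : m ≠ 0 := (lt_of_lt_of_le one_pos hm1).ne'
      have hlowpart : h ^ 2 / (2 * Real.pi) / P2 ^ 2 ≤ 1 / (2 * Real.pi * h ^ 2) * (m ^ 4)⁻¹ := by
        have hP4 : (h ^ 2 * m ^ 2) ^ 2 ≤ P2 ^ 2 := pow_le_pow_left₀ (by positivity) hPs 2
        have hc : 0 ≤ 1 / (2 * Real.pi * h ^ 2) * (m ^ 4)⁻¹ := by positivity
        rw [div_le_iff₀ (by positivity)]
        calc h ^ 2 / (2 * Real.pi) = 1 / (2 * Real.pi * h ^ 2) * (m ^ 4)⁻¹ * (h ^ 2 * m ^ 2) ^ 2 := by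
              field_simp
          _ ≤ 1 / (2 * Real.pi * h ^ 2) * (m ^ 4)⁻¹ * P2 ^ 2 := mul_le_mul_of_nonneg_left hP4 hc
      by_cases hhigh : KH ^ 2 < Real.pi ^ 2 * ‖(WithLp.toLp 2 (fun i => (k i : ℝ)) : Space)‖ ^ 2
      · rw [if_pos hhigh, add_div]
        refine add_le_add hlowpart ?_
        have hP2K : h ^ 2 * KH ^ 2 / Real.pi ^ 2 ≤ P2 := by
          rw [hP2, mul_pow, div_le_iff₀ (by positivity)]; nlinarith
        -- `(K_Hh²/π²)/P2² ≤ 1/(K_Hh²m²)` since `P2² ≥ (h²K_H²/π²)(h²m²)`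
        have hKH0 : 0 < KH := by linarith
        have hprod : h ^ 2 * KH ^ 2 / Real.pi ^ 2 * (h ^ 2 * m ^ 2) ≤ P2 ^ 2 := by
          rw [sq P2]; exact mul_le_mul hP2K hPs (by positivity) hP2pos.le
        have hc : 0 ≤ 1 / (KH * h ^ 2) * (m ^ 2)⁻¹ := by positivity
        rw [div_le_iff₀ (by positivity)]
        calc KH * h ^ 2 / Real.pi ^ 2 = 1 / (KH * h ^ 2) * (m ^ 2)⁻¹ * (h ^ 2 * KH ^ 2 / Real.pi ^ 2 * (h ^ 2 * m ^ 2)) := by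
              field_simp
          _ ≤ 1 / (KH * h ^ 2) * (m ^ 2)⁻¹ * P2 ^ 2 := mul_le_mul_of_nonneg_left hprod hc
      · rw [if_neg hhigh]
        have : 0 ≤ 1 / (KH * h ^ 2) * (m ^ 2)⁻¹ := by
          have hKH0 : 0 < KH := by linarith
          positivity
        linarith [hlowpart]
    calc _ ≤ ∑ k ∈ u.filter (fun k => 0 < univ.sup k ∧ univ.sup k < N),
          (1 / (2 * Real.pi * h ^ 2) * (((univ.sup k : ℕ) : ℝ) ^ 4)⁻¹ +
            1 / (KH * h ^ 2) * (((univ.sup k : ℕ) : ℝ) ^ 2)⁻¹) := sum_le_sum hterm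
      _ = 1 / (2 * Real.pi * h ^ 2) * ∑ k ∈ u.filter (fun k => 0 < univ.sup k ∧ univ.sup k < N), (((univ.sup k : ℕ) : ℝ) ^ 4)⁻¹ +
          1 / (KH * h ^ 2) * ∑ k ∈ u.filter (fun k => 0 < univ.sup k ∧ univ.sup k < N), (((univ.sup k : ℕ) : ℝ) ^ 2)⁻¹ := by
          rw [sum_add_distrib, mul_sum, mul_sum]
      _ ≤ 1 / (2 * Real.pi * h ^ 2) * 24 + 1 / (KH * h ^ 2) * (12 * N) := by
          have hKH0 : 0 < KH := by linarith
          apply add_le_add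
          · refine mul_le_mul_of_nonneg_left ?_ (by positivity)
            calc ∑ k ∈ u.filter (fun k => 0 < univ.sup k ∧ univ.sup k < N), (((univ.sup k : ℕ) : ℝ) ^ 4)⁻¹
                ≤ ∑ k ∈ u.filter (fun k => 1 ≤ univ.sup k), (((univ.sup k : ℕ) : ℝ) ^ 4)⁻¹ := by
                  apply sum_le_sum_of_subset_of_nonneg
                  · intro k hk
                    rw [mem_filter] at hk ⊢
                    exact ⟨hk.1, hk.2.1⟩
                  · intro k _ _; positivity
              _ ≤ 24 := sum_inv_sup_pow_four_le_24 u
          · exact mul_le_mul_of_nonneg_left (sum_inv_sup_sq_le N u) (by positivity)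
      _ = 12 / (Real.pi * h ^ 2) + 12 * N / (KH * h ^ 2) := by
          have hKH0 : KH ≠ 0 := by positivity
          field_simp
          ring
  have h6 := mul_le_mul_of_nonneg_left hδsum (by positivity : (0 : ℝ) ≤ 6 * (ρz * g0) ^ 2)
  -- the high part
  have hhigh := sum_high_tail_le hh hY0 hY0 le_rfl τ (fun k => ρz * gh k) hN hsmall
    (fun k hk => (hτfacts k (lt_of_lt_of_le hN0 hk)).1) hyabs u
  -- assemble
  rw [sum_filter_sup_pos_split hN0 u]
  refine (add_le_add (hlow.trans (add_le_add le_rfl h6)) ((sum_le_sum fun k hk => ?_).trans hhigh)).trans_eq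
    (by ring)
  -- `|A - B| ≤ |A| + B` with `B ≥ 0`
  have hk0 : 0 < univ.sup k := lt_of_lt_of_le hN0 (mem_filter.1 hk).2
  have hP2pos : 0 < (h * ‖(WithLp.toLp 2 (fun i => (k i : ℝ)) : Space)‖) ^ 2 :=
    lt_of_lt_of_le (by positivity) (hP k hk0).2
  have hB := (mul_lhyG_le hP2pos hY0).1
  exact (abs_sub _ _).trans_eq (by rw [abs_of_nonneg hB])

end Literature.MathematicalPhysics.QuantumManyBody.BoseGas
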